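import Summits.AtomisticToContinuum.Crystallization.Theorems.ChargedEnergyGapFarSourceTail
import Summits.AtomisticToContinuum.Crystallization.Theorems.ChargedEnergyGapBarlowTubeH
import HarnessLib

/-!
# Charged energy gap — lens-3 g65, node «BarlowRef» (R3) — part 27 «HoleBand»: the UNCORED share bound, PROVED (the hole band of the exhibition)

Cell `decomp-a2c`, seat lens-3, generation 65.  Imports part 22b (`…FarSourceTail`) and the tree's part 6 (`…BarlowTubeH`).  ELEMENTARY·PROVED,
crude on purpose: the HOLE members of part 25's exhibition (priced excised sites, budget `B_H`, and `B_H ≥ 0` is FREE in the record consumer) need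
`TubeShareBoundH (3/5) (101/5) ϱ' ℓ b₀ 18 θ` for SOME finite `θ`, with no core (`ϱ' = ℓ = 0`).  Here it is, for every core pair `(ϱ', ℓ)` and every
target clearance `b₀ ≥ r + 18/5 = 119/5`:

* `le_dist_of_tube_of_le_dist` — a pair `(y, z)` whose segment passes within `r` of `c` with `dist z c ≥ b₀` has `dist y z ≥ b₀ − r`
  (`exists_mem_segment_dist_le` + `dist_add_dist_of_mem_segment`);
* `source_row_mul_le` — per source `y` (ANY position): `(Σ_{z ∈ G} [test]·d⁻⁶)·V ≤ (500π/21)/(b₀ − r)³` (part 19 `inside_kernel_mul_le` with no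
  finite class, `β ≡ b₀ − r ≥ 18/5`);
* ★ `tubeLoad_uncored_le` — sources split at distance `400` from `c`: the near ones are at most `((2·400 + s)/s)³` (`IsSeparatedRef.card_le`), each
  with the row bound; the far ones are part 22's `tubeLoad_far_record_le` (`· V² ≤ 3/50`); with `V ≥ 463/1000` (`le_window_cell_volume`):
  `tubeLoad (101/5) c F G ≤ ((800 + s)/s)³ · (500π/21)/((b₀ − 101/5)³ · (463/1000)) + (3/50)/(463/1000)²` for `s`-separated Barlow images,
  `F, G ⊆ P.points`, targets `≥ b₀` from `c`, NO source condition;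
* ★★ `tubeShareBoundH_uncored_record` — `TubeShareBoundH (3/5) (101/5) ϱ' ℓ 42 18 40000000` for ALL `ϱ' ℓ` (the block count is `≥ 1`): the hole
  band `(ϱc, ℓ, b, θ) = (0, 0, 42, 4·10⁷)` of part 25's record corollary is DISCHARGED, and so is any band as a (useless-for-`B_T`) fallback.

0 sorry; standard axioms.
-/

noncomputable section

open scoped Classical

open Literature.MathematicalPhysics.StatisticalMechanics Literature.Geometry.DiscreteGeometry
open Summit.AtomisticToContinuum.Crystallization.Theses.PricedLinkCensus
open Summit.AtomisticToContinuum.Crystallization.Theorems.ChargedEnergyGapNegative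

namespace Summit.AtomisticToContinuum.Crystallization.Theorems.ChargedEnergyGapChartDial

section HoleBand

/-- A pair whose segment passes within `r` of `c`, with the target at distance `≥ b₀` from `c`, has length `≥ b₀ − r`. -/
theorem le_dist_of_tube_of_le_dist {c y z : E3} {r b₀ : ℝ} (h : Metric.infDist c (segment ℝ y z) ≤ r) (hz : b₀ ≤ dist z c) :
    b₀ - r ≤ dist y z := by
  obtain ⟨p, hp, hpc⟩ := exists_mem_segment_dist_le h
  have h1 : dist y p + dist p z = dist y z := dist_add_dist_of_mem_segment hp
  have h2 := dist_triangle z p c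
  have h3 : 0 ≤ dist y p := dist_nonneg
  rw [dist_comm z p] at h2
  linarith

/-- ★ The ROW of one source (any position): `(Σ_{z ∈ G} [y ≠ z, tube test]·d_yz⁻⁶)·V ≤ (500π/21)/(b₀ − r)³` when the targets keep distance `≥ b₀`
from `c` and `b₀ − r ≥ 18/5` (part 19's isotropic tail: every passing pair has length `≥ b₀ − r`). -/
theorem source_row_mul_le {a h : ℝ} {s : ℤ → ℤ} {g : E3 → E3}
    (ha : 9 / 10 ≤ a ∧ a ≤ 11 / 10) (hh : 0 < h ∧ 27 / 50 * a ^ 2 ≤ h ^ 2 ∧ h ^ 2 ≤ 121 / 150 * a ^ 2) (hg : Isometry g)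
    (y c : E3) {r b₀ : ℝ} (hb : 18 / 5 ≤ b₀ - r) (G : Finset E3) (hG : ↑G ⊆ g '' barlowStacking a h s) (hGb : ∀ z ∈ G, b₀ ≤ dist z c) :
    (∑ z ∈ G, if y ≠ z ∧ Metric.infDist c (segment ℝ y z) ≤ r then (dist y z)⁻¹ ^ 6 else 0) * (a * (a * √3 / 2) * h) ≤
      500 * Real.pi / 21 / (b₀ - r) ^ 3 := by
  have h1 := inside_kernel_mul_le ha hh hg y c r (fun _ => b₀ - r) 0 (fun _ => le_rfl) hb G hG
    (fun z hz _ ht => le_dist_of_tube_of_le_dist ht (hGb z hz))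
  rwa [Finset.sum_range_zero, zero_add] at h1

/-- ★ **THE UNCORED LOAD BOUND**: for an `s`-separated reference whose points form a Barlow image, every point `c`, all finite `F, G ⊆ P.points` with
the targets at distance `≥ b₀` from `c` (`b₀ − 101/5 ≥ 18/5`) and NO condition on the sources:
`tubeLoad (101/5) c F G ≤ ((800 + s)/s)³ · (500π/21)/((b₀ − 101/5)³·(463/1000)) + (3/50)/(463/1000)²`. -/
theorem tubeLoad_uncored_le {s : ℝ} {P : PeriodicConfiguration 3} (hs : 0 < s) (hsep : IsSeparatedRef s P) (hBar : IsBarlowImage P.points)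
    (c : E3) {b₀ : ℝ} (hb : 18 / 5 ≤ b₀ - 101 / 5) (F G : Finset E3) (hF : (↑F : Set E3) ⊆ P.points) (hG : (↑G : Set E3) ⊆ P.points)
    (hGb : ∀ z ∈ G, b₀ ≤ dist z c) :
    tubeLoad (101 / 5) c F G ≤
      ((2 * 400 + s) / s) ^ 3 * (500 * Real.pi / 21 / (b₀ - 101 / 5) ^ 3 / (463 / 1000)) + 3 / 50 / (463 / 1000) ^ 2 := by
  obtain ⟨a, h, sq, g, ha, hh, -, hg, hS⟩ := hBar
  rw [hS] at hF hG
  set V : ℝ := a * (a * √3 / 2) * h with hV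
  have hVl : 463 / 1000 ≤ V := le_window_cell_volume ha hh
  have hV0 : 0 < V := lt_of_lt_of_le (by norm_num) hVl
  -- split the sources at distance 400 from `c`
  set Fn := F.filter (fun y => dist y c < 400) with hFn
  set Ff := F.filter (fun y => ¬ dist y c < 400) with hFf
  have hsplit : tubeLoad (101 / 5) c F G = tubeLoad (101 / 5) c Fn G + tubeLoad (101 / 5) c Ff G := by
    unfold tubeLoad
    rw [hFn, hFf, Finset.sum_filter_add_sum_filter_not]
  -- the far sources: part 22
  have hfar : tubeLoad (101 / 5) c Ff G ≤ 3 / 50 / (463 / 1000) ^ 2 := by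
    have h1 := tubeLoad_far_record_le ha hh hg c Ff ((Finset.coe_subset.2 (Finset.filter_subset _ F)).trans hF)
      (fun y hy => by rw [hFf, Finset.mem_filter, not_lt] at hy; exact hy.2) G hG
    have h0 := tubeLoad_nonneg (101 / 5) c Ff G
    rw [le_div_iff₀ (by norm_num)]
    calc tubeLoad (101 / 5) c Ff G * (463 / 1000) ^ 2 ≤ tubeLoad (101 / 5) c Ff G * V ^ 2 :=
          mul_le_mul_of_nonneg_left (pow_le_pow_left₀ (by norm_num) hVl 2) h0
      _ ≤ 3 / 50 := by rw [hV]; exact h1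
  -- the near sources: count × row
  have hrow : ∀ y ∈ Fn, (∑ z ∈ G, if y ≠ z ∧ Metric.infDist c (segment ℝ y z) ≤ 101 / 5 then (dist y z)⁻¹ ^ 6 else 0) ≤
      500 * Real.pi / 21 / (b₀ - 101 / 5) ^ 3 / (463 / 1000) := by
    intro y _
    have h1 := source_row_mul_le ha hh hg y c hb G hG hGb
    have h0 : 0 ≤ ∑ z ∈ G, (if y ≠ z ∧ Metric.infDist c (segment ℝ y z) ≤ 101 / 5 then (dist y z)⁻¹ ^ 6 else (0 : ℝ)) :=
      Finset.sum_nonneg fun z _ => by split_ifs <;> positivity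
    rw [le_div_iff₀ (by norm_num)]
    calc (∑ z ∈ G, if y ≠ z ∧ Metric.infDist c (segment ℝ y z) ≤ 101 / 5 then (dist y z)⁻¹ ^ 6 else (0 : ℝ)) * (463 / 1000)
        ≤ (∑ z ∈ G, if y ≠ z ∧ Metric.infDist c (segment ℝ y z) ≤ 101 / 5 then (dist y z)⁻¹ ^ 6 else (0 : ℝ)) * V :=
          mul_le_mul_of_nonneg_left hVl h0
      _ ≤ _ := h1
  have hcount : (Fn.card : ℝ) ≤ ((2 * 400 + s) / s) ^ 3 :=
    hsep.card_le hs (by norm_num) c Fn fun y hy => by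
      rw [hFn, Finset.mem_filter] at hy
      exact ⟨by rw [hS]; exact hF (Finset.mem_coe.2 hy.1), hy.2.le⟩
  have hK0 : 0 ≤ 500 * Real.pi / 21 / (b₀ - 101 / 5) ^ 3 / (463 / 1000) := by
    have : 0 < b₀ - 101 / 5 := by linarith
    positivity
  have hnear : tubeLoad (101 / 5) c Fn G ≤ ((2 * 400 + s) / s) ^ 3 * (500 * Real.pi / 21 / (b₀ - 101 / 5) ^ 3 / (463 / 1000)) := by
    unfold tubeLoad
    calc ∑ y ∈ Fn, ∑ z ∈ G, (if y ≠ z ∧ Metric.infDist c (segment ℝ y z) ≤ 101 / 5 then (dist y z)⁻¹ ^ 6 else (0 : ℝ))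
        ≤ ∑ _y ∈ Fn, 500 * Real.pi / 21 / (b₀ - 101 / 5) ^ 3 / (463 / 1000) := Finset.sum_le_sum hrow
      _ = (Fn.card : ℝ) * (500 * Real.pi / 21 / (b₀ - 101 / 5) ^ 3 / (463 / 1000)) := by rw [Finset.sum_const, nsmul_eq_mul]
      _ ≤ _ := mul_le_mul_of_nonneg_right hcount hK0
  rw [hsplit]
  exact add_le_add hnear hfar

/-- RECORD ARITHMETIC: at `s = 3/5`, `b₀ = 42` the uncored bound is `< 4·10⁷` (`π < 3.1416`). -/
theorem uncored_record_arith :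
    ((2 * 400 + 3 / 5) / (3 / 5) : ℝ) ^ 3 * (500 * Real.pi / 21 / (42 - 101 / 5) ^ 3 / (463 / 1000)) + 3 / 50 / (463 / 1000) ^ 2 ≤ 40000000 := by
  have hπ := Real.pi_lt_d4
  have h1 : ((2 * 400 + 3 / 5) / (3 / 5) : ℝ) ^ 3 * (500 * Real.pi / 21 / (42 - 101 / 5) ^ 3 / (463 / 1000)) ≤
      ((2 * 400 + 3 / 5) / (3 / 5) : ℝ) ^ 3 * (500 * 3.1416 / 21 / (42 - 101 / 5) ^ 3 / (463 / 1000)) := by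
    gcongr
  have h2 : ((2 * 400 + 3 / 5) / (3 / 5) : ℝ) ^ 3 * (500 * 3.1416 / 21 / (42 - 101 / 5) ^ 3 / (463 / 1000)) + 3 / 50 / (463 / 1000) ^ 2 ≤
      40000000 := by norm_num
  linarith

/-- ★★ **THE HOLE BAND OF RECORD, DISCHARGED**: `TubeShareBoundH (3/5) (101/5) ϱ' ℓ 42 18 (4·10⁷)` for every core pair `(ϱ', ℓ)` — no core is used,
the targets' clearance `42` from the member alone bounds the load, and the block count `#(P.points ∩ B̄(q, 18)) ≥ 1`. -/
theorem tubeShareBoundH_uncored_record (ϱ' ℓ : ℝ) : TubeShareBoundH (3 / 5) (101 / 5) ϱ' ℓ 42 18 40000000 := by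
  intro P hsep hBar x₀ c q F G hF hG hq _ _ hGb _
  have h1 := tubeLoad_uncored_le (by norm_num) hsep hBar c (b₀ := 42) (by norm_num) F G hF hG hGb
  have hN : (1 : ℝ) ≤ ((P.points ∩ Metric.closedBall q 18).ncard : ℝ) := by
    have hfin := hsep.finite_inter_closedBall (by norm_num : (0 : ℝ) < 3 / 5) q 18
    exact_mod_cast (Set.ncard_pos hfin).2 ⟨q, hq, Metric.mem_closedBall_self (by norm_num)⟩
  calc tubeLoad (101 / 5) c F G ≤ 40000000 := h1.trans uncored_record_arith
    _ ≤ 40000000 * ((P.points ∩ Metric.closedBall q 18).ncard : ℝ) := by nlinarith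

end HoleBand

end Summit.AtomisticToContinuum.Crystallization.Theorems.ChargedEnergyGapChartDial
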